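import Summits.ValiantsHypothesis.ValiantsHypothesis.Theorems.GrenetZeonDualUnipotentThreeHalvesLongMassRankOne
import Summits.ValiantsHypothesis.ValiantsHypothesis.Theorems.GrenetZeonDualUnipotentThreeHalvesLongMassLedgerTorus

/-!
# `GrenetZeon.DualUnipotentThreeHalves` (stmt-ValiantsHypothesis-24318), line `slow_core`, stub `stub_longMassSlowLawInv` ((c)):
# the per-coordinate census instrument counts only RANK-≥ 2 coordinates

By-name corollary of ✓ `LongMassRankOne.ledger_one_span_single` in the currency of the census kill of record
✓ `InitialForm.LedgerTorus.not_relCert_of_count` (val-idea-28 g5): a coordinate `e` whose coefficient matrix `[x_e] N` is an outer product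
(rank `≤ 1`) lies in the WINDOW CONE of every order `k ≥ 1` (`windowCone_single_of_rankOne`); hence the number of coordinates outside the
window cone of order `k ≥ 1` is at most the number of coordinates of coefficient-rank `≥ 2` (`card_not_windowCone_le_card_not_rankOne`), and the
count hypothesis of `not_relCert_of_count` at price `P` forces `P < n + #{e : rank [x_e]N ≥ 2}` (`count_criterion_needs_rankTwo`).
ENEMY-SPEC READING (crit-7 V34 §2): a (c)-violator family certified by the count instrument at price `c·√n·b` carries more than `c·√n·b − n`
coordinates whose coefficient matrices have rank `≥ 2`.  Honest framing: bookkeeping on an instrument; NOT progress on (c)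
`SlowCore.LongMassSlowLawInv`; (c), S3, 24318, 8062, VP ≠ VNP OPEN / NOT proved.  No sorry, no definitions, no named facts.
-/

-- single-conjunct layout: Sub = Summit, duplicated namespace component intended (the name is mandated)
set_option linter.dupNamespace false
set_option autoImplicit false

noncomputable section

namespace Summit.ValiantsHypothesis.ValiantsHypothesis.Theorems.GrenetZeon.LongMassRankOne

open MvPolynomial Matrix
open Summit.ValiantsHypothesis.ValiantsHypothesis.Cruxes.TwoDimCoefficients.DimTwoCases (AffMat IsAffine)
open Summit.ValiantsHypothesis.ValiantsHypothesis.Theorems.GrenetZeon.RadicalSplit (lineSubst)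
open Summit.ValiantsHypothesis.ValiantsHypothesis.Theorems.GrenetZeon.SlowCore (Ledger RelCert linEntry)
open Summit.ValiantsHypothesis.ValiantsHypothesis.Theorems.GrenetZeon.InitialForm.LedgerTorus (WindowCone not_relCert_of_count)

variable {n m : ℕ}

/-- A rank-one coordinate lies in the window cone of every order `k ≥ 1`. [this file] -/
theorem windowCone_single_of_rankOne (N : AffMat n m) (hN : IsAffine N) {H : ℕ} (hnil : N ^ H = 0) (e : Fin n × Fin n)
    (u w : Fin m → ℂ) (he : ∀ i j, coeff (Finsupp.single e 1) (N i j) = u i * w j) {k : ℕ} (hk : 1 ≤ k) :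
    WindowCone N k (Pi.single e (1 : ℂ)) := by
  intro x b _ i j
  exact (totalDegree_pow_map_lineSubst_le_one_of_rankOne N hN hnil x _ u w (fun i j => by rw [linEntry_single, he i j]) b i j).trans hk

open Classical in
/-- **The census sees only rank-≥ 2 coordinates**: at every order `k ≥ 1`, the coordinates OUTSIDE the window cone are among the coordinates
whose coefficient matrix is NOT an outer product. [this file] -/
theorem card_not_windowCone_le_card_not_rankOne (N : AffMat n m) (hN : IsAffine N) {H : ℕ} (hnil : N ^ H = 0) {k : ℕ} (hk : 1 ≤ k) :
    (Finset.univ.filter fun e : Fin n × Fin n => ¬ WindowCone N k (Pi.single e (1 : ℂ))).card ≤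
      (Finset.univ.filter fun e : Fin n × Fin n =>
        ¬ ∃ u w : Fin m → ℂ, ∀ i j, coeff (Finsupp.single e 1) (N i j) = u i * w j).card := by
  refine Finset.card_le_card fun e he => ?_
  rw [Finset.mem_filter] at he ⊢
  refine ⟨he.1, fun ⟨u, w, huw⟩ => he.2 (windowCone_single_of_rankOne N hN hnil e u w huw hk)⟩

open Classical in
/-- Complement count: `#(in the cone of order k) ≥ #(rank-≤ 1 coordinates)`, stated as `n² − #cone_k ≤ #(not rank-one)`. [this file] -/
theorem sq_sub_card_windowCone_le (N : AffMat n m) (hN : IsAffine N) {H : ℕ} (hnil : N ^ H = 0) {k : ℕ} (hk : 1 ≤ k) :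
    n * n - (Finset.univ.filter fun e : Fin n × Fin n => WindowCone N k (Pi.single e (1 : ℂ))).card ≤
      (Finset.univ.filter fun e : Fin n × Fin n =>
        ¬ ∃ u w : Fin m → ℂ, ∀ i j, coeff (Finsupp.single e 1) (N i j) = u i * w j).card := by
  have hsplit := Finset.card_filter_add_card_filter_not
    (s := (Finset.univ : Finset (Fin n × Fin n))) (fun e : Fin n × Fin n => WindowCone N k (Pi.single e (1 : ℂ)))
  rw [Finset.card_univ, Fintype.card_prod, Fintype.card_fin] at hsplit
  have h := card_not_windowCone_le_card_not_rankOne N hN hnil hk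
  omega

open Classical in
/-- ★ **THE COUNT CRITERION NEEDS RANK TWO.**  If the hypothesis of ✓ `not_relCert_of_count` holds at price `P` (for every order `k`, the
coordinate count already exceeds `P`), then `P < n + #{e : [x_e]N is not an outer product}`: a violator certified by the per-coordinate census at
price `c·√n·b` has more than `c·√n·b − n` coordinates of coefficient-rank `≥ 2`.  (Instantiate the count at `k = 1`.) [this file] -/
theorem count_criterion_needs_rankTwo (N : AffMat n m) (hN : IsAffine N) {H : ℕ} (hnil : N ^ H = 0) (P : ℕ)
    (hcount : ∀ k : ℕ,
      P < n * k + (n * n - (Finset.univ.filter fun e : Fin n × Fin n => WindowCone N k (Pi.single e (1 : ℂ))).card)) :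
    P < n + (Finset.univ.filter fun e : Fin n × Fin n =>
        ¬ ∃ u w : Fin m → ℂ, ∀ i j, coeff (Finsupp.single e 1) (N i j) = u i * w j).card := by
  have h1 := hcount 1
  have h2 := sq_sub_card_windowCone_le N hN hnil (le_refl 1)
  omega

open Classical in
/-- The same read as a NECESSARY CONDITION for a census kill: if at most `P − n` coordinates have coefficient-rank `≥ 2` (and `n ≤ P`), the count
hypothesis of `not_relCert_of_count` FAILS at order `1`, so the instrument cannot certify `¬ RelCert n m N P`. [this file] -/
theorem not_count_of_few_rankTwo (N : AffMat n m) (hN : IsAffine N) {H : ℕ} (hnil : N ^ H = 0) (P : ℕ)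
    (hfew : n + (Finset.univ.filter fun e : Fin n × Fin n =>
        ¬ ∃ u w : Fin m → ℂ, ∀ i j, coeff (Finsupp.single e 1) (N i j) = u i * w j).card ≤ P) :
    ¬ ∀ k : ℕ,
      P < n * k + (n * n - (Finset.univ.filter fun e : Fin n × Fin n => WindowCone N k (Pi.single e (1 : ℂ))).card) :=
  fun hcount => absurd (count_criterion_needs_rankTwo N hN hnil P hcount) (not_lt.mpr hfew)

end Summit.ValiantsHypothesis.ValiantsHypothesis.Theorems.GrenetZeon.LongMassRankOne

end
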